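import Mathlib
import Literature.Geometry.Riemannian.ChangGurskyYangProofs
import Literature.Geometry.Riemannian.ChangGurskyYang
import Literature.Geometry.Riemannian.YamabeConstant
import Literature.Geometry.Riemannian.YamabePositivity
import HarnessLib

/-!
# ChangGurskyYangTheorem14

Topic `Literature/Geometry/Riemannian`. Named literature fact(s) relocated by the gate from `Summits/SmoothPoincare4/SmoothPoincare4/Theorems/EntropyRungChangGurskyYangStubThm14Psc.lean`
(accept-time relocation of `[cite]`d propositions written inline in a Summits proposal; human ruling 2026-08-15).
Sources: ChangGurskyYang2003.

* `Literature.Geometry.Riemannian.changGurskyYang_theorem14_four`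
-/

namespace Literature.Geometry.Riemannian

open scoped Manifold ContDiff Topology ENNReal
open Literature.Geometry.Lorentzian Literature.Geometry.Lorentzian.PseudoRiemannianMetric
open Literature.Geometry.Riemannian MeasureTheory Module

/-- **Chang–Gursky–Yang 2003, Thm. 1.4 (`α = 1`).** On a smooth closed CONNECTED four-manifold
`(M⁴, g₀)` with positive Yamabe invariant `Y(M⁴,[g₀]) > 0`, if
`∫σ₂(A_{g₀}) dvol_{g₀} − ¼∫|W_{g₀}|² dvol_{g₀} > 0` ((1.9) with `α = 1`; `A = Ric − (R/6) g` the
Weyl–Schouten tensor, `σ₂(A) = −½|E|² + R²/24`, `|W|² = W_{ijkl}W^{ijkl}` the `(0,4)`-norm), then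
there is a conformal metric `g = e^{2w} g₀` with `σ₂(A_g) − ¼|W_g|² > 0` pointwise ((1.10) with
`α = 1`). Stated in the tree's vocabulary: `yamabeConstant` (`YamabeConstant.lean`: Lee–Parker 1987,
(1.5) = Chang–Gursky–Yang 2003, Remark 1), `weylEnergy = ∫|W|² dV ∈ ℝ≥0∞` (finite on a closed
manifold, `weylEnergy_lt_top`, so `.toReal` loses nothing), `sigma2WeylSchoutenIntegral = ∫σ₂(A) dV`,
`weylNormSq`, `sigma2WeylSchouten`, and `IsConformalTo` on the bundled `C^∞` Riemannian metrics
(`toContMDiffRiemannianMetric`); the conformal metric is `C^∞`, Riemannian, and carries a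
Levi-Civita connection (automatic in print). CONNECTEDNESS IS LOAD-BEARING and is the paper's
standing convention: with `[ConnectedSpace M]` dropped (verbatim the hypothesis `hThm14` of
`changGurskyYang_sphere_four_of_margerin_of_chernGaussBonnet_of_thm14`) the statement is false on
`S⁴ ⊔ S³×S¹` (`Y > 0`, `¼∫|W|² = 0 < 16π² = ∫σ₂(A)`, but `∫σ₂(A_g) dV_g = 0` for every metric `g`
conformal to the product metric on the `S³×S¹` component, by the conformal invariance of `∫σ₂(A) dV`
(p. 110), so `σ₂(A_g) > ¼|W_g|² = 0` cannot hold pointwise there). A deep theorem (the fully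
nonlinear conformal PDE of [CGY1], Ann. of Math. 155 (2002), via a `δ`-regularised fourth-order
equation and degree theory; alternatively Gursky–Viaclovsky 2003, Thm. 1, by the continuity method
with the Weyl weight carried on the right-hand side): no `_holds`. (The body is written without
scoped notation — `modelWithCornersSelf ℝ (EuclideanSpace ℝ (Fin 4))` for `𝓡 4`,
`((⊤ : ℕ∞) : WithTop ℕ∞)` for the smoothness exponent `∞` — and with fully qualified tree names, so
that it elaborates under any `open` preamble; it is syntactically the statement `Thm14LeafConnected`
of the crux's Disproof §7.)
[cite: ChangGurskyYang2003, Thm. 1.4, (1.9)–(1.10), pp. 112–113]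
[file Geometry/Riemannian/ChangGurskyYangTheorem14] -/
def changGurskyYang_theorem14_four : Prop :=
  ∀ (M : Type) [TopologicalSpace M] [T2Space M] [SecondCountableTopology M]
    [ChartedSpace (EuclideanSpace ℝ (Fin 4)) M]
    [IsManifold (modelWithCornersSelf ℝ (EuclideanSpace ℝ (Fin 4))) ((⊤ : ℕ∞) : WithTop ℕ∞) M]
    [CompactSpace M] [ConnectedSpace M] [MeasurableSpace M] [BorelSpace M]
    (g₀ : Literature.Geometry.Lorentzian.PseudoRiemannianMetric
      (modelWithCornersSelf ℝ (EuclideanSpace ℝ (Fin 4))) ((⊤ : ℕ∞) : WithTop ℕ∞)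
      (EuclideanSpace ℝ (Fin 4))
      (TangentSpace (modelWithCornersSelf ℝ (EuclideanSpace ℝ (Fin 4))) : M → Type _))
    [g₀.HasLeviCivita] (hg₀ : g₀.IsRiemannian),
    0 < Literature.Geometry.Riemannian.yamabeConstant (g₀.toContMDiffRiemannianMetric hg₀) →
    1 / 4 * g₀.weylEnergy.toReal < g₀.sigma2WeylSchoutenIntegral →
    ∃ (g : Literature.Geometry.Lorentzian.PseudoRiemannianMetric
        (modelWithCornersSelf ℝ (EuclideanSpace ℝ (Fin 4))) ((⊤ : ℕ∞) : WithTop ℕ∞)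
        (EuclideanSpace ℝ (Fin 4))
        (TangentSpace (modelWithCornersSelf ℝ (EuclideanSpace ℝ (Fin 4))) : M → Type _))
      (_ : g.HasLeviCivita) (hg : g.IsRiemannian),
      Literature.Geometry.Riemannian.IsConformalTo (g.toContMDiffRiemannianMetric hg)
        (g₀.toContMDiffRiemannianMetric hg₀) ∧
      ∀ x, 1 / 4 * g.weylNormSq x < g.sigma2WeylSchouten x
-- TODO(general form): Chang–Gursky–Yang 2003, Thm. 1.4 carries the Weyl weight `(α/4)|W|²` with a
-- parameter `α` in (1.9)–(1.10); only the case `α = 1` used in their §2 (proof of Thm. A) is stated.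

end Literature.Geometry.Riemannian
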